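import Summits.CriticalPhenomena.SAWScalingLimit.Theses.SAWQuarterTwist

/-!
# Line `birth` — registered skeleton for the crux `BulkScalingLimitExists` (stmt-CriticalPhenomena-16651)

Crux (FIXED; rank 3 of `route-CriticalPhenomena-SAWQuarterTwist`, sub-problem `SAWScalingLimit`): for every
Dobrushin domain `D`, interior point `p`, admissible hexagonal discretisations `Λ_δ` (simply connected,
connected, inside `Ω`, the exact lattice in a ball `B(p, ρ) ⊆ Ω`, exhausting compacts) and source cells `x_δ`
with `δ · triEmbed x_δ → p`, there are `ψ`-independent normalisers `n_δ` and a limit functional `ℓ`, nonzero on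
some bulk test function, with `n_δ δ² Σ_e ψ(δ mid e) F^tw_δ(e) → ℓ(ψ)` as `δ → 0⁺` for every bulk test
function `ψ ∈ C_c(Ω ∖ {p})`; here `F^tw_δ(e) = Σ_γ x_c^{|γ|} e^{-i(5/8)W(γ)} i^{N(γ)}` is the quarter-twisted
interior-source SAW parafermion of the route (source = left vertical side of the hexagon at `x_δ`, `N` = signed
crossings of the horizontal cut to the right).

## The cut — existence of a limit = NON-DEGENERATE SELF-NORMALISATION + WEAK-* EXTRACTION + IDENTIFICATION

The normaliser is free in the crux, so the content is the convergence of the RATIOS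
`R_δ(ψ) = ⟨ψ, F_δ⟩ / ⟨ψ₀, F_δ⟩` of smeared pairings for a reference bulk test function `ψ₀` (the refuter's
reading, R2-review on the item).  A limit along the arbitrary-in-`δ` family `Λ_δ` exists iff the ratios are
(a) eventually bounded and (b) have a single cluster value.  The line types these halves separately:

* S1 `stub_dominantAnchor` (OPEN — a-priori bound / non-cancellation; the recorded why-might-fail lives here):
  for admissible data there is an ANCHOR `ψ₀ ∈ C_c(Ω∖p)`: its pairing `⟨ψ₀, F_δ⟩` is eventually non-zero and
  DOMINATES every bulk pairing, `‖⟨ψ, F_δ⟩‖ ≤ C_ψ ‖⟨ψ₀, F_δ⟩‖` eventually.  This is the order-zero a-priori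
  bound of the half-Cauchy–Riemann barrier (no Harnack / maximum principle for Morera-closed SAW currents):
  lattice-scale phase noise could make one smeared pairing `o(mass)`.  NECESSARY: the crux implies it (ratios
  converge ⇒ bounded; `n_δ δ²⟨ψ₀,F_δ⟩ → ℓψ₀ ≠ 0` ⇒ non-vanishing).
* S2 `stub_weakStarExtraction` (DETERMINISTIC functional analysis, landable now, size L): for ANY anchor and any
  sequence `δ_k → 0⁺` there is a subsequence along which `R_{δ_k}(ψ)` converges for every bulk test `ψ`
  simultaneously.  Proof: `R_k` are finite-atomic linear functionals; per-`ψ` boundedness + Banach–Steinhaus on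
  the Banach spaces `C_K = {ψ : supp ψ ⊆ K}` give uniform bounds `M_K`; `C_K` is separable; diagonal
  extraction over a countable dense family and an `M_K`-Lipschitz density argument.  No SAW input.
* S3 `stub_limitIdentification` (OPEN — the identification half): for admissible data and ANY anchor `ψ₀`, two
  sequential weak-* limit functionals of the `ψ₀`-normalised pairings COINCIDE on bulk tests.  Mechanism
  foreseen by the route: exact Morera-closedness of `F^tw` off the cut (support item `QuarterTwistRelation`)
  passes to measure-valued limits (`∂̄`-Weyl ⇒ holomorphic), the boundary winding fixes `arg` on `∂Ω`, the
  quarter flux fixes the monodromy at `p`; uniqueness of that `σ = 5/8` Riemann–Hilbert problem up to the one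
  real scalar pinned by `R(ψ₀) = 1`.  NECESSARY: the crux implies it (for an anchor `ψ₀`, domination applied to
  the crux's own `ψ₀*` gives `ℓ ψ₀ ≠ 0`, so every sequential limit is `ℓψ/ℓψ₀`).

So `crux ⟺ S1 ∧ S3` given the theorem S2 — an honest equivalence split whose two open halves are strictly
weaker than the crux and differ in mechanism (a-priori bound vs. uniqueness of the continuum problem).
`BulkScalingLimitExists_of` (kernel-checked, no `sorry` of its own) is the subsequence principle on the
countably generated filter `𝓝[>] 0` (`Filter.tendsto_of_subseq_tendsto`): reference limit `L` from S2 along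
`δ_k = 1/(k+1)`; for an arbitrary sequence S2 extracts `(φ, L')`, S3 gives `L' = L`; normaliser
`n_δ := (δ² ⟨ψ₀, F_δ⟩)⁻¹`, so that `n_δ δ² ⟨ψ, F_δ⟩ = R_δ(ψ)` for `δ > 0`; `ℓ ψ₀ = L ψ₀ = 1 ≠ 0` because
`R_δ(ψ₀) = 1` eventually.  It concludes the route decl BY NAME through
`bulkScalingLimitExists_iff : BulkScalingLimitExists' ↔ BulkScalingLimitExists := Iff.rfl` (the primed form is
the crux with its three `let`s delta-reduced into the §1 vocabulary; the file re-opens the route file's scopes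
so that the `if … then … else` instances coincide).

Disproof / negatives used: no `Cruxes/BulkScalingLimitExists/Disproof.lean` exists (`ledger crux ls
stmt-CriticalPhenomena-16651`: no workfiles, 2026-08-17), so there is no `_false_without_` obstruction to honour
and no landed `Theorems/BulkScalingLimitExists/Negative/*`; `ledger negatives --problem CriticalPhenomena`: the
SAW entries (all-`δ` tightness stmt-0772, unpinned HexObservableLimit stmt-5420, phase retrieval stmt-8312) are
not touched — every statement below is eventual in `δ`, bulk-sourced, and carries no boundary normalisation.
Vacuity pass: `Admissible` is satisfiable (disc, exact lattice in `B(p,ρ)`, exhausting `Λ_δ` — refuter R2);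
S1 is not vacuous (it asserts an eventually non-zero pairing); S2/S3 quantify over anchors, which exist only
via S1 (if no anchor exists S2/S3 are vacuous but then S1 is false and the line dies at S1, as it should);
`ratio` at a zero denominator is the junk value `0`, never met eventually along an anchor.
-/

noncomputable section

-- the route file's scopes, re-opened verbatim so that elaboration (instances of the `if`s, coercions)
-- coincides with the crux's and `bulkScalingLimitExists_iff` below is `Iff.rfl`
open scoped BigOperators Topology Manifold Classical MeasureTheory ProbabilityTheory Matrix InnerProductSpace ComplexConjugate ContinuousMap
open Filter Set Function TopologicalSpace MeasureTheory
open Literature.Probability.RandomPlanarGeometry Literature.Probability.LatticeModels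

namespace Summit.CriticalPhenomena.SAWScalingLimit.Cruxes.BulkScalingLimitExists.Birth

/-! ### 1. Vocabulary — the crux's three `let`s as definitions, pairings, ratios, admissibility -/

/-- The cut sign `sgn_s(p, q) ∈ {1, −1, 0}` of a directed lattice step `p → q`: `±1` exactly on the vertical
edges crossed by the horizontal ray from the source hexagon `x s` to the right (up = `+1`).
VERBATIM the crux's `let sgn`. -/
def sgn (x : ℝ → Site 2) : ℝ → HexVertex → HexVertex → ℤ := fun s p q =>
  if q.2 = 0 ∧ p.2 = 1 ∧ p.1 = q.1 - Pi.single 1 1 ∧ q.1 1 = x s 1 ∧ x s 0 ≤ q.1 0 then 1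
  else if p.2 = 0 ∧ q.2 = 1 ∧ q.1 = p.1 - Pi.single 1 1 ∧ p.1 1 = x s 1 ∧ x s 0 ≤ p.1 0 then -1 else 0

/-- The source mid-edge `a s`: the left vertical side of the hexagon at the cell `x s`.
VERBATIM the crux's `let a`. -/
def src (x : ℝ → Site 2) : ℝ → Sym2 HexVertex := fun s =>
  s((x s - Pi.single 0 1, (0 : Fin 2)), (x s - Pi.single 0 1 - Pi.single 1 1, (1 : Fin 2)))

/-- The quarter-twisted interior-source parafermion `F^tw_s(z) = Σ_γ x_c^{|γ|} e^{-i(5/8)W(γ)} i^{N(γ)}` over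
mid-edge SAWs of `Λ s` from the source `a s` to `z`.  VERBATIM the crux's `let F`. -/
def Ftw (Λ : ℝ → Finset HexVertex) (x : ℝ → Site 2) : ℝ → Sym2 HexVertex → ℂ := fun s z =>
  ∑ γ : Literature.Probability.RandomPlanarGeometry.SAW.HexMidEdgeSAW (Λ s) (src x s) z,
    γ.weight Literature.Probability.RandomPlanarGeometry.SAW.hexCriticalFugacity (5 / 8) *
      Complex.I ^ ((γ.verts.zip γ.verts.tail).map (fun pq => sgn x s pq.1 pq.2)).sum

/-- The smeared pairing `⟨ψ, F_δ⟩ := Σ_{e ∈ midEdges Λ_δ} ψ(δ · mid e) F^tw_δ(e)` (WITHOUT the factor `δ²`,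
exactly the `finsum` of the crux). -/
def pairing (Λ : ℝ → Finset HexVertex) (x : ℝ → Site 2) (ψ : ℂ → ℂ) (δ : ℝ) : ℂ :=
  ∑ᶠ e ∈ Literature.Probability.RandomPlanarGeometry.SAW.hexDomainMidEdges (Λ δ),
    ψ ((δ : ℂ) * Literature.Probability.RandomPlanarGeometry.SAW.hexMidpoint e) * Ftw Λ x δ e

/-- The self-normalised ratio `R_δ(ψ) = ⟨ψ, F_δ⟩ / ⟨ψ₀, F_δ⟩` against the reference `ψ₀`
(junk value `0` when the denominator vanishes). -/
def ratio (Λ : ℝ → Finset HexVertex) (x : ℝ → Site 2) (ψ₀ ψ : ℂ → ℂ) (δ : ℝ) : ℂ :=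
  pairing Λ x ψ δ / pairing Λ x ψ₀ δ

/-- Bulk test functions of `(Ω, p)`: `ψ ∈ C_c(Ω ∖ {p})`, VERBATIM the crux's three hypotheses on `ψ`. -/
def IsBulkTest (D : DobrushinDomain) (p : ℂ) (ψ : ℂ → ℂ) : Prop :=
  Continuous ψ ∧ HasCompactSupport ψ ∧ tsupport ψ ⊆ D.carrier \ {p}

/-- Admissible data `(D, p, ρ, Λ, x)`: the conjunction of the crux's six hypotheses, VERBATIM
(`p ∈ Ω`, `0 < ρ`, `B(p, ρ) ⊆ Ω`; eventually `Λ_δ` simply connected, connected, inside `Ω` and the exact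
lattice in `B(p, ρ)`; `Λ_δ` exhausts compacts; `δ · triEmbed (x δ) → p`). -/
def Admissible (D : DobrushinDomain) (p : ℂ) (ρ : ℝ) (Λ : ℝ → Finset HexVertex) (x : ℝ → Site 2) : Prop :=
  p ∈ D.carrier ∧ 0 < ρ ∧ Metric.ball p ρ ⊆ D.carrier ∧
  (∀ᶠ δ : ℝ in nhdsWithin 0 (Set.Ioi 0),
    Literature.Probability.RandomPlanarGeometry.SAW.hexDomainSimplyConnected (Λ δ) ∧
    (hexGraph.induce ((Λ δ : Finset HexVertex) : Set HexVertex)).Preconnected ∧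
    (∀ v ∈ Λ δ, (δ : ℂ) * hexCenter v ∈ D.carrier) ∧
    (∀ v : HexVertex, (δ : ℂ) * hexCenter v ∈ Metric.ball p ρ → v ∈ Λ δ)) ∧
  (∀ K : Set ℂ, IsCompact K → K ⊆ D.carrier → ∀ᶠ δ : ℝ in nhdsWithin 0 (Set.Ioi 0),
    ∀ v : HexVertex, (δ : ℂ) * hexCenter v ∈ K → v ∈ Λ δ) ∧
  Filter.Tendsto (fun δ : ℝ => (δ : ℂ) * triEmbed (x δ)) (nhdsWithin 0 (Set.Ioi 0)) (nhds p)

/-- An ANCHOR for `(D, p, Λ, x)`: a bulk test function `ψ₀` whose pairing is eventually non-zero and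
dominates every bulk pairing eventually (`‖⟨ψ, F_δ⟩‖ ≤ C_ψ ‖⟨ψ₀, F_δ⟩‖`). -/
def IsAnchor (D : DobrushinDomain) (p : ℂ) (Λ : ℝ → Finset HexVertex) (x : ℝ → Site 2) (ψ₀ : ℂ → ℂ) :
    Prop :=
  IsBulkTest D p ψ₀ ∧ (∀ᶠ δ : ℝ in nhdsWithin 0 (Set.Ioi 0), pairing Λ x ψ₀ δ ≠ 0) ∧
  ∀ ψ : ℂ → ℂ, IsBulkTest D p ψ → ∃ C : ℝ, ∀ᶠ δ : ℝ in nhdsWithin 0 (Set.Ioi 0),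
    ‖pairing Λ x ψ δ‖ ≤ C * ‖pairing Λ x ψ₀ δ‖

/-- Sequential weak-* convergence of the `ψ₀`-normalised pairings along a sequence `u` of meshes to the
functional `L`, tested on bulk test functions. -/
def SeqLimit (D : DobrushinDomain) (p : ℂ) (Λ : ℝ → Finset HexVertex) (x : ℝ → Site 2) (ψ₀ : ℂ → ℂ)
    (u : ℕ → ℝ) (L : (ℂ → ℂ) → ℂ) : Prop :=
  ∀ ψ : ℂ → ℂ, IsBulkTest D p ψ → Filter.Tendsto (fun k => ratio Λ x ψ₀ ψ (u k)) Filter.atTop (nhds (L ψ))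

/-! ### 2. The three statements of the line, named -/

/-- **S1, named — a dominant anchor exists** (a-priori bound / non-cancellation). -/
def DominantAnchor : Prop :=
  ∀ (D : DobrushinDomain) (p : ℂ) (ρ : ℝ) (Λ : ℝ → Finset HexVertex) (x : ℝ → Site 2),
    Admissible D p ρ Λ x → ∃ ψ₀ : ℂ → ℂ, IsAnchor D p Λ x ψ₀

/-- **S2, named — sequential weak-* extraction** (functional analysis): along any sequence of meshes
`u k → 0⁺` the normalised pairings of an anchor have a simultaneously convergent subsequence. -/
def WeakStarExtraction : Prop :=
  ∀ (D : DobrushinDomain) (p : ℂ) (Λ : ℝ → Finset HexVertex) (x : ℝ → Site 2) (ψ₀ : ℂ → ℂ),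
    IsAnchor D p Λ x ψ₀ → ∀ u : ℕ → ℝ, Filter.Tendsto u Filter.atTop (nhdsWithin 0 (Set.Ioi 0)) →
      ∃ φ : ℕ → ℕ, StrictMono φ ∧ ∃ L : (ℂ → ℂ) → ℂ, SeqLimit D p Λ x ψ₀ (u ∘ φ) L

/-- **S3, named — identification**: for admissible data and an anchor, any two sequential weak-* limits of
the normalised pairings coincide on bulk test functions. -/
def LimitIdentification : Prop :=
  ∀ (D : DobrushinDomain) (p : ℂ) (ρ : ℝ) (Λ : ℝ → Finset HexVertex) (x : ℝ → Site 2),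
    Admissible D p ρ Λ x → ∀ ψ₀ : ℂ → ℂ, IsAnchor D p Λ x ψ₀ →
      ∀ (u u' : ℕ → ℝ) (L L' : (ℂ → ℂ) → ℂ),
        Filter.Tendsto u Filter.atTop (nhdsWithin 0 (Set.Ioi 0)) →
        Filter.Tendsto u' Filter.atTop (nhdsWithin 0 (Set.Ioi 0)) →
        SeqLimit D p Λ x ψ₀ u L → SeqLimit D p Λ x ψ₀ u' L' →
          ∀ ψ : ℂ → ℂ, IsBulkTest D p ψ → L ψ = L' ψ

/-- The crux with its three `let`s delta-reduced into the §1 vocabulary (definitionally the route decl, see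
`bulkScalingLimitExists_iff`). -/
def BulkScalingLimitExists' : Prop :=
  ∀ (D : DobrushinDomain) (p : ℂ) (ρ : ℝ) (Λ : ℝ → Finset HexVertex) (x : ℝ → Site 2),
    p ∈ D.carrier → 0 < ρ → Metric.ball p ρ ⊆ D.carrier →
    (∀ᶠ δ : ℝ in nhdsWithin 0 (Set.Ioi 0),
      Literature.Probability.RandomPlanarGeometry.SAW.hexDomainSimplyConnected (Λ δ) ∧
      (hexGraph.induce ((Λ δ : Finset HexVertex) : Set HexVertex)).Preconnected ∧
      (∀ v ∈ Λ δ, (δ : ℂ) * hexCenter v ∈ D.carrier) ∧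
      (∀ v : HexVertex, (δ : ℂ) * hexCenter v ∈ Metric.ball p ρ → v ∈ Λ δ)) →
    (∀ K : Set ℂ, IsCompact K → K ⊆ D.carrier → ∀ᶠ δ : ℝ in nhdsWithin 0 (Set.Ioi 0),
      ∀ v : HexVertex, (δ : ℂ) * hexCenter v ∈ K → v ∈ Λ δ) →
    Filter.Tendsto (fun δ : ℝ => (δ : ℂ) * triEmbed (x δ)) (nhdsWithin 0 (Set.Ioi 0)) (nhds p) →
    ∃ (n : ℝ → ℂ) (ℓ : (ℂ → ℂ) → ℂ),
      (∃ ψ₀ : ℂ → ℂ, Continuous ψ₀ ∧ HasCompactSupport ψ₀ ∧ tsupport ψ₀ ⊆ D.carrier \ {p} ∧ ℓ ψ₀ ≠ 0) ∧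
      ∀ ψ : ℂ → ℂ, Continuous ψ → HasCompactSupport ψ → tsupport ψ ⊆ D.carrier \ {p} →
        Filter.Tendsto (fun δ : ℝ => n δ * (δ : ℂ) ^ 2 *
          ∑ᶠ e ∈ Literature.Probability.RandomPlanarGeometry.SAW.hexDomainMidEdges (Λ δ),
            ψ ((δ : ℂ) * Literature.Probability.RandomPlanarGeometry.SAW.hexMidpoint e) * Ftw Λ x δ e)
          (nhdsWithin 0 (Set.Ioi 0)) (nhds (ℓ ψ))

/-- The primed form IS the route decl: `BulkScalingLimitExists` unfolds (delta, then zeta on `sgn`, `a`, `F`,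
then delta on the §1 vocabulary) to `BulkScalingLimitExists'`. -/
theorem bulkScalingLimitExists_iff :
    BulkScalingLimitExists' ↔
      Summit.CriticalPhenomena.SAWScalingLimit.Theses.SAWQuarterTwist.BulkScalingLimitExists :=
  Iff.rfl

/-! ### 3. The registered stubs (the ONLY `sorry`s of this file) -/

/-- **S1 — dominant anchor** (OPEN; a-priori bound, the crux's recorded why-might-fail): for admissible data
`(D, p, ρ, Λ, x)` there is a bulk test function `ψ₀ ∈ C_c(Ω ∖ p)` whose smeared pairing `⟨ψ₀, F^tw_δ⟩` is
eventually non-zero as `δ → 0⁺` and eventually dominates the pairing of every bulk test function up to a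
constant.  Necessary for the crux; no tool in print for `n = 0` (no positivity behind the phases
`e^{-i5W/8} i^N`; the unsigned two-point function only bounds pairings from above). -/
theorem stub_dominantAnchor :
    ∀ (D : DobrushinDomain) (p : ℂ) (ρ : ℝ) (Λ : ℝ → Finset HexVertex) (x : ℝ → Site 2),
      Admissible D p ρ Λ x → ∃ ψ₀ : ℂ → ℂ, IsAnchor D p Λ x ψ₀ := by
  sorry

/-- **S2 — sequential weak-* extraction** (deterministic functional analysis, landable now, size L): for an
anchor `ψ₀` and a sequence of meshes `u k → 0⁺` there are a subsequence `φ` and a functional `L` with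
`R_{u (φ k)}(ψ) → L ψ` for every bulk test `ψ`.  Proof sketch: the `R_k` are linear in `ψ` (finite sums) and
pointwise bounded in `k` (domination + finitely many early terms); Banach–Steinhaus on the Banach spaces
`C_K` of continuous functions supported in a compact `K ⊆ Ω ∖ p` gives uniform bounds; exhaust `Ω ∖ p` by
compacts `K_m`, take countable dense families in the separable `C_{K_m}`, extract diagonally, and conclude by
an `M_{K_m}`-Lipschitz (Cauchy) density argument; `L ψ :=` the limit (anything off bulk tests). -/
theorem stub_weakStarExtraction :
    ∀ (D : DobrushinDomain) (p : ℂ) (Λ : ℝ → Finset HexVertex) (x : ℝ → Site 2) (ψ₀ : ℂ → ℂ),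
      IsAnchor D p Λ x ψ₀ → ∀ u : ℕ → ℝ, Filter.Tendsto u Filter.atTop (nhdsWithin 0 (Set.Ioi 0)) →
        ∃ φ : ℕ → ℕ, StrictMono φ ∧ ∃ L : (ℂ → ℂ) → ℂ, SeqLimit D p Λ x ψ₀ (u ∘ φ) L := by
  sorry

/-- **S3 (HARDEST) — identification of sequential limits** (OPEN): for admissible data and an anchor `ψ₀`,
any two sequential weak-* limits `L, L'` of the `ψ₀`-normalised pairings (along any two sequences of meshes
`→ 0⁺`) agree on bulk test functions.  Foreseen mechanism: Morera-closedness of `F^tw` off the cut (exact,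
support item `QuarterTwistRelation`) passes to the measure-valued limits, which are then holomorphic on
`Ω ∖ (p ∪ cut)` with multiplicative jump `i` across the cut; boundary winding fixes the argument on `∂Ω`;
uniqueness of this `σ = 5/8` Riemann–Hilbert problem up to one scalar, pinned by `R(ψ₀) = 1`. -/
theorem stub_limitIdentification :
    ∀ (D : DobrushinDomain) (p : ℂ) (ρ : ℝ) (Λ : ℝ → Finset HexVertex) (x : ℝ → Site 2),
      Admissible D p ρ Λ x → ∀ ψ₀ : ℂ → ℂ, IsAnchor D p Λ x ψ₀ →
        ∀ (u u' : ℕ → ℝ) (L L' : (ℂ → ℂ) → ℂ),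
          Filter.Tendsto u Filter.atTop (nhdsWithin 0 (Set.Ioi 0)) →
          Filter.Tendsto u' Filter.atTop (nhdsWithin 0 (Set.Ioi 0)) →
          SeqLimit D p Λ x ψ₀ u L → SeqLimit D p Λ x ψ₀ u' L' →
            ∀ ψ : ℂ → ℂ, IsBulkTest D p ψ → L ψ = L' ψ := by
  sorry

/-! ### Consistency: each named statement IS its registered stub (definitionally) -/

theorem dominantAnchor_holds : DominantAnchor := stub_dominantAnchor
theorem weakStarExtraction_holds : WeakStarExtraction := stub_weakStarExtraction
theorem limitIdentification_holds : LimitIdentification := stub_limitIdentification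

/-! ### Name-keyed aliases of the three statements — the hypotheses of `BulkScalingLimitExists_of`

The skeleton audit (`#h21_check_skeleton`) admits a hypothesis of the skeleton theorem only if its head
constant is a registered obligation or is NAMED like a declared stub; `__Registered.stub_X` is the statement
of `stub_X` under that name (device of `Cruxes/AsymptoticMorera/Lines/birth.lean`).  Each alias is `rfl`-equal
to its statement. -/
namespace __Registered

/-- Alias of `DominantAnchor` keyed by the registered stub name. -/
abbrev stub_dominantAnchor : Prop := DominantAnchor
/-- Alias of `WeakStarExtraction` keyed by the registered stub name. -/
abbrev stub_weakStarExtraction : Prop := WeakStarExtraction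
/-- Alias of `LimitIdentification` keyed by the registered stub name. -/
abbrev stub_limitIdentification : Prop := LimitIdentification

end __Registered

/-! ### 4. The sorry-free part: the subsequence principle -/

/-- The reference sequence of meshes `δ_k = 1/(k+1) → 0⁺`. -/
theorem tendsto_refSeq :
    Filter.Tendsto (fun k : ℕ => 1 / ((k : ℝ) + 1)) Filter.atTop (nhdsWithin 0 (Set.Ioi 0)) := by
  refine tendsto_nhdsWithin_iff.2 ⟨tendsto_one_div_add_atTop_nhds_zero_nat, ?_⟩
  exact Filter.Eventually.of_forall fun k => by
    show (0 : ℝ) < 1 / ((k : ℝ) + 1)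
    positivity

/-- Along an anchor, the self-ratio `R_δ(ψ₀)` tends to `1` on every sequence of meshes `u k → 0⁺`. -/
theorem tendsto_ratio_self {D : DobrushinDomain} {p : ℂ} {Λ : ℝ → Finset HexVertex} {x : ℝ → Site 2}
    {ψ₀ : ℂ → ℂ} (hA : IsAnchor D p Λ x ψ₀) {u : ℕ → ℝ}
    (hu : Filter.Tendsto u Filter.atTop (nhdsWithin 0 (Set.Ioi 0))) :
    Filter.Tendsto (fun k => ratio Λ x ψ₀ ψ₀ (u k)) Filter.atTop (nhds 1) := by
  have hev : ∀ᶠ k in Filter.atTop, ratio Λ x ψ₀ ψ₀ (u k) = 1 :=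
    (hu.eventually hA.2.1).mono fun k hk => div_self hk
  exact tendsto_const_nhds.congr' (hev.mono fun k hk => hk.symm)

/-- **The composition in the delta-reduced form** (no `sorry`): S1, S2, S3 imply `BulkScalingLimitExists'`
by the subsequence principle on the countably generated filter `𝓝[>] 0`. -/
theorem bulkScalingLimitExists'_of (h1 : DominantAnchor) (h2 : WeakStarExtraction)
    (h3 : LimitIdentification) : BulkScalingLimitExists' := by
  intro D p ρ Λ x hp hρ hball hΛ hK hx
  have hAdm : Admissible D p ρ Λ x := ⟨hp, hρ, hball, hΛ, hK, hx⟩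
  -- S1: an anchor
  obtain ⟨ψ₀, hA⟩ := h1 D p ρ Λ x hAdm
  -- S2 along the reference sequence: the candidate limit functional `L`
  obtain ⟨φ₀, hφ₀, L, hL⟩ := h2 D p Λ x ψ₀ hA _ tendsto_refSeq
  have hu₀ : Filter.Tendsto ((fun k : ℕ => 1 / ((k : ℝ) + 1)) ∘ φ₀) Filter.atTop
      (nhdsWithin 0 (Set.Ioi 0)) :=
    tendsto_refSeq.comp hφ₀.tendsto_atTop
  refine ⟨fun δ => ((δ : ℂ) ^ 2 * pairing Λ x ψ₀ δ)⁻¹, L, ⟨ψ₀, hA.1.1, hA.1.2.1, hA.1.2.2, ?_⟩, ?_⟩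
  · -- `L ψ₀ = 1`
    have h1' : Filter.Tendsto (fun k => ratio Λ x ψ₀ ψ₀ (((fun k : ℕ => 1 / ((k : ℝ) + 1)) ∘ φ₀) k))
        Filter.atTop (nhds (L ψ₀)) := hL ψ₀ hA.1
    have hone := tendsto_ratio_self hA hu₀
    rw [tendsto_nhds_unique h1' hone]
    exact one_ne_zero
  · intro ψ hψc hψs hψt
    have hψ : IsBulkTest D p ψ := ⟨hψc, hψs, hψt⟩
    -- every sequence of meshes has a subsequence along which `R(ψ) → L ψ`
    have key : Filter.Tendsto (fun δ => ratio Λ x ψ₀ ψ δ) (nhdsWithin 0 (Set.Ioi 0)) (nhds (L ψ)) := by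
      refine Filter.tendsto_of_subseq_tendsto fun u hu => ?_
      obtain ⟨φ, hφ, L', hL'⟩ := h2 D p Λ x ψ₀ hA u hu
      have hEq : L ψ = L' ψ :=
        h3 D p ρ Λ x hAdm ψ₀ hA _ _ L L' hu₀ (hu.comp hφ.tendsto_atTop) hL hL' ψ hψ
      exact ⟨φ, by rw [hEq]; exact hL' ψ hψ⟩
    -- and the normalised pairing IS the ratio for `δ > 0`
    refine key.congr' ?_
    have hpos : ∀ᶠ δ in nhdsWithin (0 : ℝ) (Set.Ioi 0), (0 : ℝ) < δ :=
      eventually_mem_nhdsWithin.mono fun δ hδ => hδ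
    filter_upwards [hpos] with δ hδ
    have hδ2 : (δ : ℂ) ^ 2 ≠ 0 := pow_ne_zero _ (Complex.ofReal_ne_zero.mpr hδ.ne')
    show pairing Λ x ψ δ / pairing Λ x ψ₀ δ =
      ((δ : ℂ) ^ 2 * pairing Λ x ψ₀ δ)⁻¹ * (δ : ℂ) ^ 2 * pairing Λ x ψ δ
    rw [mul_inv, mul_right_comm ((δ : ℂ) ^ 2)⁻¹, inv_mul_cancel₀ hδ2, one_mul, ← div_eq_inv_mul]

/-! ### 5. The skeleton theorem: the three stubs imply the crux, BY NAME -/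

/-- **`BulkScalingLimitExists` from the line `birth`** (kernel-checked, no `sorry` of its own): hypotheses =
the three stubs under their registered names; conclusion = the route decl, by name. -/
theorem BulkScalingLimitExists_of (h1 : __Registered.stub_dominantAnchor)
    (h2 : __Registered.stub_weakStarExtraction) (h3 : __Registered.stub_limitIdentification) :
    Summit.CriticalPhenomena.SAWScalingLimit.Theses.SAWQuarterTwist.BulkScalingLimitExists :=
  bulkScalingLimitExists_iff.mp (bulkScalingLimitExists'_of h1 h2 h3)

/-- Wiring check (an `example`, so that `BulkScalingLimitExists_of` stays the only theorem concluding the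
crux): the registered stubs, with their stated types, feed the skeleton theorem — this term becomes the crux
proof when the three `sorry`s above are discharged. -/
example : Summit.CriticalPhenomena.SAWScalingLimit.Theses.SAWQuarterTwist.BulkScalingLimitExists :=
  BulkScalingLimitExists_of stub_dominantAnchor stub_weakStarExtraction stub_limitIdentification

end Summit.CriticalPhenomena.SAWScalingLimit.Cruxes.BulkScalingLimitExists.Birth

end
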